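import Summits.HodgeConjecture.CorCM.GaloisAnnihilatorCertificates
import HarnessLib

/-!
# BAD is monotone under a totally real cyclic factor: a certificate for `Γ₀` gives one for `Γ₀ × C_n`, every `n ≥ 3`

COR-CM (cell `pub-hodgecm2`), binder seat b04 (gen 30), count-neutral own lane «Galois-CM-type classification» (which Galois CM
fields `(G, c)` have ALL primitive CM types nondegenerate = GOOD, vs. a primitive degenerate type = BAD).  KERNEL ONLY: theorems;
no definition, no named fact, no `sorry`.  `HC_CM` is neither used nor claimed.

The lineage's BAD theorems for individual groups `Γ₀` are (or end in) ANNIHILATOR CERTIFICATES in the format of gen 24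
`CorCM/GaloisAnnihilatorCertificates.exists_simple_degenerate_of_model_annihilator`: a CM set `T₀ ⊂ Γ₀` for `c₀` with trivial left
stabiliser and a non-zero `c₀`-antisymmetric `b : Γ₀ → ℤ` annihilated by all right translates of `T₀`.  THIS FILE: such a
certificate for `(Γ₀, c₀)` yields one for `(Γ₀ × C_n, (c₀, 1))` for EVERY `n ≥ 3`, with NO hypothesis on `Γ₀`:
`T = {(g, v) : g ∈ T₀ (v ≠ t), g ∉ T₀ (v = t)}` (`t` a fixed generator, i.e. the right translate `T₀ c₀` in the fibre over `t`)
and `B(g, v) = 𝟙[v = 1]·b(g)`.  CM is clear; the left stabiliser is trivial because a period `(a, k)` with `k ≠ 0` can be tested on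
two fibres `v, v + k ∉ {t}` (they exist as `n ≥ 3`), forcing `a = 1`, and then on the pair of fibres `{t − k, t}` where membership
flips; `B` is annihilated because the fibre over `t⁻¹v⁻¹…` is `T₀` (sum `0` by hypothesis) or its complement (sum `Σ_Γ₀ b = 0` by
antisymmetry).

THEOREM (**`exists_simple_degenerate_prod_cyclic_of_certificate`**).  `K` Galois CM with `e : Gal(K/ℚ) ≃* Γ₀ × C_n`, `n ≥ 3`,
complex conjugation `(c₀, 1)`, and an annihilator certificate `(T₀, b)` for `(Γ₀, c₀)` ⟹ `K` carries a SIMPLE DEGENERATE abelian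
variety of dimension `n|Γ₀|/2` with CM by `K` (rational `(p,p)` class outside the divisor ring on some power).  So **a totally real
cyclic factor of degree `≥ 3` never rescues a certified-BAD group** — complementing gen 24's real-factor theorem (which needs only a
PRIMITIVE type of `Γ₀` but excludes `H ∈ {C₂, C₂², C₂³, C₄, C_p, S₃}`): here `H = C₄, C_p` (and every `C_n`, `n ≥ 3`) are covered
from a certificate.  Every table/annihilator/balanced-set certificate of gens 17–28 (`D₁₆`, `SD₃₂`, `M₃₂`, the order-24/32 rows,
`C_p ⋊ C₈` and `Q₈ × C_p` norm-pair certificates, …) thus extends to `× C_n`, `n ≥ 3`.  (For `n = 2` the analogous type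
`T₀ ⊔ (T₀w)t` needs a right translate `T₀w` that is no left translate `aT₀` with `a² = 1`; such `w` exists unless `Γ₀ ≅ C₂ᵏ`, but
this is not formalised here — see `CorCM/GaloisIndexTwoTimesTwo` for the `× C₂` theorem of the index-two setting.)

## References

* [Kubota1965] T. Kubota, *On the field extension by complex multiplication*, Trans. AMS 118 (1965), §2, §4 Lemma 2.
* [Shimura1998] G. Shimura, *Abelian Varieties with Complex Multiplication and Modular Functions*, §6.2 Thm. 3, §8.2 Prop. 26.
* [Gordon1999HodgeAVSurvey] B. B. Gordon, *A survey of the Hodge conjecture for abelian varieties*, Thm. 6.4, §9.3.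
-/

noncomputable section

open CategoryTheory CategoryTheory.Limits NumberField
open scoped BigOperators

namespace Summit.HodgeConjecture.CorCM.GaloisModels

open Literature.NumberTheory.ComplexMultiplication
open Literature.AlgebraicGeometry.Motives (AbelianVariety CMType)
open Literature.AlgebraicGeometry.HodgeTheory
open Literature.AlgebraicGeometry.ComplexMultiplication (IsCMTypeRealisation)
open Literature.AlgebraicGeometry.Pohlmann1968
open Literature.Barriers.HodgeConjecture (divisorClassesSpan)

section Model

variable {Γ₀ : Type*} [Group Γ₀] [Fintype Γ₀] [DecidableEq Γ₀] {n : ℕ} [NeZero n]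

omit [DecidableEq Γ₀] in
/-- **An antisymmetric function sums to zero** over the whole group: `Σ b = Σ b(c₀ ·) = −Σ b`. [folklore] -/
theorem sum_eq_zero_of_antisymm (c₀ : Γ₀) (b : Γ₀ → ℤ) (hanti : ∀ y, b (c₀ * y) = -b y) (g : Γ₀) :
    ∑ h : Γ₀, b (h * g) = 0 := by
  have h1 : ∑ h : Γ₀, b (h * g) = ∑ h : Γ₀, b (c₀ * h * g) :=
    (Fintype.sum_bijective (fun h => c₀ * h) (Group.mulLeft_bijective c₀) _ _ fun h => rfl).symm
  have h2 : ∑ h : Γ₀, b (c₀ * h * g) = -∑ h : Γ₀, b (h * g) := by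
    rw [← Finset.sum_neg_distrib]
    exact Finset.sum_congr rfl fun h _ => by rw [mul_assoc, hanti]
  omega

/-- **The lifted certificate is annihilated.**  With `T = {(g, v) : v = t → g ∉ T₀, v ≠ t → g ∈ T₀}` and `B(g, v) = 𝟙[v = 1] b(g)`:
`Σ_{s ∈ T} B(s·(g, v)) = Σ_{h ∈ T_{v⁻¹}} b(h g) = 0`. [folklore] -/
theorem lifted_annihilated (c₀ : Γ₀) (T₀ : Finset Γ₀) (b : Γ₀ → ℤ) (hanti : ∀ y, b (c₀ * y) = -b y) (hann : ∀ g : Γ₀, ∑ s ∈ T₀, b (s * g) = 0)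
    (t : Multiplicative (ZMod n)) (g : Γ₀) (v : Multiplicative (ZMod n)) :
    ∑ s ∈ (Finset.univ.filter fun w : Γ₀ × Multiplicative (ZMod n) => if w.2 = t then w.1 ∉ T₀ else w.1 ∈ T₀),
      (if (s * (g, v)).2 = 1 then b (s * (g, v)).1 else 0) = 0 := by
  classical
  -- only the fibre over `v⁻¹` contributes
  rw [Finset.sum_ite, Finset.sum_const_zero, add_zero]
  -- rewrite the contributing set as the image of a subset of `Γ₀` under `h ↦ (h, v⁻¹)`
  have hset : ((Finset.univ.filter fun w : Γ₀ × Multiplicative (ZMod n) => if w.2 = t then w.1 ∉ T₀ else w.1 ∈ T₀).filter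
      fun s => (s * (g, v)).2 = 1) =
      (Finset.univ.filter fun h : Γ₀ => if v⁻¹ = t then h ∉ T₀ else h ∈ T₀).image fun h => (h, v⁻¹) := by
    ext ⟨h, u⟩
    simp only [Finset.mem_filter, Finset.mem_univ, true_and, Finset.mem_image, Prod.mk_mul_mk, Prod.mk.injEq]
    constructor
    · rintro ⟨hm, hu⟩
      have hu' : u = v⁻¹ := eq_inv_of_mul_eq_one_left hu
      subst hu'
      exact ⟨h, hm, rfl, rfl⟩
    · rintro ⟨h', hm, rfl, rfl⟩
      exact ⟨hm, inv_mul_cancel v⟩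
  rw [hset, Finset.sum_image (fun x _ y _ hxy => (Prod.mk.inj hxy).1)]
  simp only [Prod.mk_mul_mk]
  by_cases hv : v⁻¹ = t
  · simp only [hv, if_true]
    -- complement of `T₀`: total sum minus the `T₀`-sum
    have hsplit := Finset.sum_filter_add_sum_filter_not Finset.univ (fun h : Γ₀ => h ∈ T₀) (fun h => b (h * g))
    rw [sum_eq_zero_of_antisymm c₀ b hanti g] at hsplit
    have hT : (Finset.univ.filter fun h : Γ₀ => h ∈ T₀) = T₀ := by ext h; simp
    rw [hT, hann g, zero_add] at hsplit
    exact hsplit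
  · simp only [hv, if_false]
    have hT : (Finset.univ.filter fun h : Γ₀ => h ∈ T₀) = T₀ := by ext h; simp
    rw [hT]
    exact hann g

end Model

section Field

variable {Γ₀ : Type*} [Group Γ₀] [Fintype Γ₀] [DecidableEq Γ₀]
variable {K : Type} [Field K] [NumberField K] [IsCMField K] [IsGalois ℚ K]

/-- **A CERTIFIED-BAD GROUP STAYS BAD TIMES `C_n`, `n ≥ 3`.**  `e : Gal(K/ℚ) ≃* Γ₀ × C_n` with `n ≥ 3` and complex conjugation
`(c₀, 1)`; `T₀ ⊂ Γ₀` a CM set for `c₀` with trivial left stabiliser and `b : Γ₀ → ℤ` a non-zero `c₀`-antisymmetric function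
annihilated by all right translates of `T₀` (an annihilator certificate for `(Γ₀, c₀)`) ⟹ `K` carries a SIMPLE DEGENERATE abelian
variety of dimension `n|Γ₀|/2` with CM by `K` (rational `(p,p)` class outside the divisor ring on some power).
[cite: Kubota1965, §2 and §4 Lemma 2] [cite: Shimura1998, §6.2 Thm. 3 and §8.2 Prop. 26] [cite: Gordon1999HodgeAVSurvey, Thm. 6.4 and §9.3] -/
theorem exists_simple_degenerate_prod_cyclic_of_certificate {n : ℕ} [NeZero n] (hn : 3 ≤ n)
    (e : (K ≃ₐ[ℚ] K) ≃* Γ₀ × Multiplicative (ZMod n)) (c₀ : Γ₀)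
    (hc : e ((IsCMField.complexConj K).restrictScalars ℚ) = (c₀, 1)) (T₀ : Finset Γ₀)
    (hcm : ∀ x : Γ₀, x ∈ T₀ ↔ c₀ * x ∉ T₀) (hprim : ∀ v : Γ₀, v ≠ 1 → ∃ w : Γ₀, ¬ (w ∈ T₀ ↔ v * w ∈ T₀))
    (b : Γ₀ → ℤ) (hanti : ∀ y, b (c₀ * y) = -b y) (hann : ∀ g : Γ₀, ∑ s ∈ T₀, b (s * g) = 0) (hb : ∃ y, b y ≠ 0) :
    ∃ (Φ : CMType K) (φ₀ : K →+* ℂ) (X : AbelianVariety ℂ) (ι : 𝓞 K →+* End X)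
      (ϑ : K →+* Module.End ℂ (complexBetti X.X 1)),
      IsPrimitive (ℂ ≃+* ℂ) Φ.1 φ₀ ∧ ¬ IsNondegenerate Φ ∧ IsCMTypeRealisation Φ X ι ϑ ∧ X.IsSimple ∧
      X.dim = Fintype.card Γ₀ * n / 2 ∧
      ∃ m p : ℕ, ∃ y : complexBetti (⨁ fun _ : Fin m => X).X (2 * p), IsRationalClass y ∧
        IsOfHodgeType (⨁ fun _ : Fin m => X).dim (⨁ fun _ : Fin m => X).X (2 * p) p p y ∧
        y ∉ divisorClassesSpan (⨁ fun _ : Fin m => X).X (⨁ fun _ : Fin m => X).dim p := by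
  classical
  haveI : Fact (1 < n) := ⟨by omega⟩
  set t : Multiplicative (ZMod n) := Multiplicative.ofAdd 1 with ht_def
  have ht1 : t ≠ 1 := by
    rw [ht_def, Ne, ← ofAdd_zero, Multiplicative.ofAdd.injective.eq_iff]; exact one_ne_zero
  -- the lifted type
  set T : Finset (Γ₀ × Multiplicative (ZMod n)) :=
    Finset.univ.filter fun w => if w.2 = t then w.1 ∉ T₀ else w.1 ∈ T₀ with hT_def
  have hTmem : ∀ (g : Γ₀) (v : Multiplicative (ZMod n)), (g, v) ∈ T ↔ (if v = t then g ∉ T₀ else g ∈ T₀) := fun g v => by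
    simp only [hT_def, Finset.mem_filter, Finset.mem_univ, true_and]
  have hTne : ∀ (g : Γ₀) {v : Multiplicative (ZMod n)}, v ≠ t → ((g, v) ∈ T ↔ g ∈ T₀) := fun g v hv => by
    rw [hTmem, if_neg hv]
  have hTt : ∀ g : Γ₀, (g, t) ∈ T ↔ g ∉ T₀ := fun g => by rw [hTmem, if_pos rfl]
  -- CM
  have hcm' : ∀ w, w ∈ T ↔ ((c₀, 1) : Γ₀ × Multiplicative (ZMod n)) * w ∉ T := by
    rintro ⟨g, v⟩
    rw [Prod.mk_mul_mk, one_mul]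
    by_cases hv : v = t
    · subst hv; rw [hTt, hTt, not_not, hcm g, not_not]
    · rw [hTne g hv, hTne (c₀ * g) hv]; exact hcm g
  -- trivial left stabiliser
  have hprim' : ∀ w : Γ₀ × Multiplicative (ZMod n), w ≠ 1 → ∃ s, ¬ (s ∈ T ↔ w * s ∈ T) := by
    rintro ⟨a, κ⟩ hne
    by_cases hκ : κ = 1
    · subst hκ
      have ha : a ≠ 1 := fun h => hne (by rw [h]; rfl)
      obtain ⟨g, hg⟩ := hprim a ha
      refine ⟨(g, 1), ?_⟩
      rwa [Prod.mk_mul_mk, mul_one, hTne g ht1.symm, hTne (a * g) ht1.symm]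
    · -- a fibre `v` with `v ≠ t` and `κ v ≠ t`
      obtain ⟨v, hv, hκv⟩ : ∃ v : Multiplicative (ZMod n), v ≠ t ∧ κ * v ≠ t := by
        set k := Multiplicative.toAdd κ with hk
        have hκ' : κ = Multiplicative.ofAdd k := by rw [hk, ofAdd_toAdd]
        have hk0 : k ≠ 0 := fun h => hκ (by rw [hκ', h, ofAdd_zero])
        have h20 : (2 : ZMod n) ≠ 0 := by
          intro h
          have : ((2 : ℕ) : ZMod n) = 0 := by exact_mod_cast h
          rw [ZMod.natCast_eq_zero_iff] at this
          exact absurd (Nat.le_of_dvd (by norm_num) this) (by omega)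
        by_cases hk1 : k = 1
        · refine ⟨Multiplicative.ofAdd 2, ?_, ?_⟩
          · rw [ht_def, Ne, Multiplicative.ofAdd.injective.eq_iff]
            intro h; exact one_ne_zero (by linear_combination h : (1 : ZMod n) = 0)
          · rw [hκ', hk1, ← ofAdd_add, ht_def, Ne, Multiplicative.ofAdd.injective.eq_iff]
            intro h; exact h20 (by linear_combination h)
        · refine ⟨Multiplicative.ofAdd 0, ?_, ?_⟩
          · rw [ht_def, Ne, Multiplicative.ofAdd.injective.eq_iff]; exact zero_ne_one
          · rw [hκ', ← ofAdd_add, add_zero, ht_def, Ne, Multiplicative.ofAdd.injective.eq_iff]; exact hk1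
      by_cases ha : a = 1
      · -- `a = 1`, `κ ≠ 1`: the fibres `κ⁻¹ t` and `t`
        subst ha
        refine ⟨(1, κ⁻¹ * t), ?_⟩
        have hne' : κ⁻¹ * t ≠ t := fun h => hκ (inv_eq_one.1 (mul_right_cancel (h.trans (one_mul t).symm)))
        rw [Prod.mk_mul_mk, one_mul, mul_inv_cancel_left, hTne 1 hne', hTt]
        exact iff_not_self
      · obtain ⟨g, hg⟩ := hprim a ha
        refine ⟨(g, v), ?_⟩
        rwa [Prod.mk_mul_mk, hTne g hv, hTne (a * g) hκv]
  -- the lifted annihilator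
  let B : Γ₀ × Multiplicative (ZMod n) → ℤ := fun w => if w.2 = 1 then b w.1 else 0
  have hanti' : ∀ w, B (((c₀, 1) : Γ₀ × Multiplicative (ZMod n)) * w) = -B w := by
    rintro ⟨g, v⟩
    simp only [B, Prod.mk_mul_mk, one_mul]
    split_ifs
    · exact hanti g
    · simp
  have hann' : ∀ w : Γ₀ × Multiplicative (ZMod n), ∑ s ∈ T, B (s * w) = 0 := by
    rintro ⟨g, v⟩
    exact lifted_annihilated c₀ T₀ b hanti hann t g v
  have hb' : ∃ w, B w ≠ 0 := by
    obtain ⟨y, hy⟩ := hb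
    exact ⟨(y, 1), by simpa [B] using hy⟩
  obtain ⟨Φ, φ₀, X, ι, ϑ, h1, h2, h3, h4, h5, h6⟩ :=
    exists_simple_degenerate_of_model_annihilator e (c₀, 1) hc T hcm' hprim' B hanti' hann' hb'
  refine ⟨Φ, φ₀, X, ι, ϑ, h1, h2, h3, h4, ?_, h6⟩
  rw [h5, Fintype.card_prod, Fintype.card_multiplicative, ZMod.card]

end Field

end Summit.HodgeConjecture.CorCM.GaloisModels

end
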